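import Summits.CriticalPhenomena.PercolationContinuityZ3.Theorems.PercNearOneGluingNoHeavyLowerTailThreePointProductFormFibreSeriesPiecePointwise
import HarnessLib

/-!
# The series piece, III: its six statistics in terms of the sub-instance (Sahi programme, prover prim-sahi-p2 gen 59)

Support file (`--supports stmt-CriticalPhenomena-4575`, helper); continues `…ThreePointProductFormFibreSeriesPiecePointwise` (same gen).
Standard axioms, no sorries, no named facts, no definitions.  Memo `run/shared/lean/prim/prim-sahi/FROM-prim-sahi-p2-gen59-ONE-STEP-LEMMA.md` §2, §8(2);
`prim-sahi-p2/PROOF-E3.md` (68j), §69.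

For the series piece `Q = {e} ∪ Qᵤ` (`e` a label `a — u`, `u ≠ a`, the labels of `Qᵤ` avoiding `a`, `e ∉ Qᵤ`; `s, c ≠ a`) and the counts over all
configurations `z : α → Bool` of the sub-instance `w = z|_{Qᵤ}` with terminals `(s, u, c)` — `r = #S0 = #{s, c isolated}`, `p = #{c isolated}`,
`q = #{s isolated}`, `N = #{s ↮ c}` (so `N + r = p + q`), `g = #good = #{S0 ∧ c ↮ s in the restricted flat at u}` — the six statistics of the piece
w.r.t. `(s, a, c)` (`x = z|_Q`, restricted flat `(♭ₐ x)|_Q`) satisfy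
`2·#S0 = N + r`, `2·#isoC = N + p`, `2·#isoS = N + q`, `2·Ga = p + g`, `2·Gb = q + g`, `2·G1 = r + g`
(`two_mul_card_series_S0/isoC/isoS/Ga/Gb/G1`) — the per-child factors `σ = p+q`, `σ+P1 = 2p+q−r`, `σ+P2`, `p+g`, `q+g`, `r+g` of the tree
recursion of gen 58 (68j) (`…ThreePointProductFormTreeRecursion`), up to the factor 2.
[this work] (gen 59).
-/

namespace Summit.CriticalPhenomena.PercolationContinuityZ3.Theorems.ProductFormFibre

open Finset Literature.Probability.Percolation
open Summit.CriticalPhenomena.PercolationContinuityZ3.Theorems.ThreePointCPIClusterSwap (clusterFlip)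

variable {V α : Type*}

/-! ### 3. The counts -/

section SeriesCounts

variable [Fintype α] [DecidableEq α] [DecidableEq V]
  (ends : α → Sym2 V) (s a c u : V) (e : α) (Qu : α → Prop) [DecidablePred Qu]
  (he : ends e = s(a, u)) (hua : u ≠ a) (hsa : s ≠ a) (hca : c ≠ a) (hQu : ∀ l, Qu l → ∀ v ∈ ends l, v ≠ a) (heQ : ¬ Qu e)

open Classical in
include he hua hsa hca hQu heQ in
/-- **Series piece, `2·#S0(piece) = #{s ↮ c} + #S0(sub)`** (sub-instance `(Qᵤ; s, u, c)`, counts over all configurations). [this work] -/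
theorem two_mul_card_series_S0 :
    2 * (univ.filter fun z : α → Bool =>
        ((¬ (openGraph (labelledOpen ends fun y => z y && decide (y = e ∨ Qu y))).Reachable s a ∧
        ¬ (openGraph (labelledOpen ends fun y => z y && decide (y = e ∨ Qu y))).Reachable s c) ∧
        (¬ (openGraph (labelledOpen ends fun y => z y && decide (y = e ∨ Qu y))).Reachable c a ∧
        ¬ (openGraph (labelledOpen ends fun y => z y && decide (y = e ∨ Qu y))).Reachable c s))).card =
    (univ.filter fun z : α → Bool =>
        (¬ (openGraph (labelledOpen ends fun y => z y && decide (Qu y))).Reachable s c ∧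
        ¬ (openGraph (labelledOpen ends fun y => z y && decide (Qu y))).Reachable c s)).card +
    (univ.filter fun z : α → Bool =>
        ((¬ (openGraph (labelledOpen ends fun y => z y && decide (Qu y))).Reachable s u ∧
        ¬ (openGraph (labelledOpen ends fun y => z y && decide (Qu y))).Reachable s c) ∧
        (¬ (openGraph (labelledOpen ends fun y => z y && decide (Qu y))).Reachable c u ∧
        ¬ (openGraph (labelledOpen ends fun y => z y && decide (Qu y))).Reachable c s))).card := by
  have hW := restrictU_update_apply e Qu heQ
  have r0 : ∀ (P₀ P₁ : Prop), ((false = false ∧ P₀) ∨ (false = true ∧ P₁)) ↔ P₀ := fun P₀ P₁ => by simp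
  have r1 : ∀ (P₀ P₁ : Prop), ((true = false ∧ P₀) ∨ (true = true ∧ P₁)) ↔ P₁ := fun P₀ P₁ => by simp
  refine two_mul_card_filter_split e _ _ _ (fun z b => by simp only [hW]) (fun z b => by simp only [hW]) fun z => ?_
  cases hz : z e
  · obtain ⟨a1, a2, a3, a4⟩ := series_closed ends a u e Qu he hua hQu heQ z hz hsa hca
    obtain ⟨b1, b2, b3, b4⟩ := series_closed ends a u e Qu he hua hQu heQ z hz hca hsa
    rw [r0]
    rw [a1, a2, b1, b2]
    clear a3 a4 b3 b4
    simp only [not_false_eq_true, true_and]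
  · obtain ⟨a1, a2, a3, a4⟩ := series_open ends a u e Qu he hua hQu heQ z hz hsa hca
    obtain ⟨b1, b2, b3, b4⟩ := series_open ends a u e Qu he hua hQu heQ z hz hca hsa
    rw [r1]
    rw [a1, a2, b1, b2]


open Classical in
include he hua hsa hca hQu heQ in
/-- **Series piece, `2·#isoC(piece) = #{c ↮ s} + #isoC(sub)`** (sub-instance `(Qᵤ; s, u, c)`, counts over all configurations). [this work] -/
theorem two_mul_card_series_isoC :
    2 * (univ.filter fun z : α → Bool =>
        (¬ (openGraph (labelledOpen ends fun y => z y && decide (y = e ∨ Qu y))).Reachable c a ∧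
        ¬ (openGraph (labelledOpen ends fun y => z y && decide (y = e ∨ Qu y))).Reachable c s)).card =
    (univ.filter fun z : α → Bool =>
        (¬ (openGraph (labelledOpen ends fun y => z y && decide (Qu y))).Reachable c s)).card +
    (univ.filter fun z : α → Bool =>
        (¬ (openGraph (labelledOpen ends fun y => z y && decide (Qu y))).Reachable c u ∧
        ¬ (openGraph (labelledOpen ends fun y => z y && decide (Qu y))).Reachable c s)).card := by
  have hW := restrictU_update_apply e Qu heQ
  have r0 : ∀ (P₀ P₁ : Prop), ((false = false ∧ P₀) ∨ (false = true ∧ P₁)) ↔ P₀ := fun P₀ P₁ => by simp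
  have r1 : ∀ (P₀ P₁ : Prop), ((true = false ∧ P₀) ∨ (true = true ∧ P₁)) ↔ P₁ := fun P₀ P₁ => by simp
  refine two_mul_card_filter_split e _ _ _ (fun z b => by simp only [hW]) (fun z b => by simp only [hW]) fun z => ?_
  cases hz : z e
  · obtain ⟨a1, a2, a3, a4⟩ := series_closed ends a u e Qu he hua hQu heQ z hz hsa hca
    obtain ⟨b1, b2, b3, b4⟩ := series_closed ends a u e Qu he hua hQu heQ z hz hca hsa
    rw [r0]
    rw [b1, b2]
    clear a1 a2 a3 a4 b3 b4
    simp only [not_false_eq_true, true_and]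
  · obtain ⟨a1, a2, a3, a4⟩ := series_open ends a u e Qu he hua hQu heQ z hz hsa hca
    obtain ⟨b1, b2, b3, b4⟩ := series_open ends a u e Qu he hua hQu heQ z hz hca hsa
    rw [r1]
    rw [b1, b2]


open Classical in
include he hua hsa hca hQu heQ in
/-- **Series piece, `2·#isoS(piece) = #{s ↮ c} + #isoS(sub)`** (sub-instance `(Qᵤ; s, u, c)`, counts over all configurations). [this work] -/
theorem two_mul_card_series_isoS :
    2 * (univ.filter fun z : α → Bool =>
        (¬ (openGraph (labelledOpen ends fun y => z y && decide (y = e ∨ Qu y))).Reachable s a ∧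
        ¬ (openGraph (labelledOpen ends fun y => z y && decide (y = e ∨ Qu y))).Reachable s c)).card =
    (univ.filter fun z : α → Bool =>
        (¬ (openGraph (labelledOpen ends fun y => z y && decide (Qu y))).Reachable s c)).card +
    (univ.filter fun z : α → Bool =>
        (¬ (openGraph (labelledOpen ends fun y => z y && decide (Qu y))).Reachable s u ∧
        ¬ (openGraph (labelledOpen ends fun y => z y && decide (Qu y))).Reachable s c)).card := by
  have hW := restrictU_update_apply e Qu heQ
  have r0 : ∀ (P₀ P₁ : Prop), ((false = false ∧ P₀) ∨ (false = true ∧ P₁)) ↔ P₀ := fun P₀ P₁ => by simp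
  have r1 : ∀ (P₀ P₁ : Prop), ((true = false ∧ P₀) ∨ (true = true ∧ P₁)) ↔ P₁ := fun P₀ P₁ => by simp
  refine two_mul_card_filter_split e _ _ _ (fun z b => by simp only [hW]) (fun z b => by simp only [hW]) fun z => ?_
  cases hz : z e
  · obtain ⟨a1, a2, a3, a4⟩ := series_closed ends a u e Qu he hua hQu heQ z hz hsa hca
    obtain ⟨b1, b2, b3, b4⟩ := series_closed ends a u e Qu he hua hQu heQ z hz hca hsa
    rw [r0]
    rw [a1, a2]
    clear a3 a4 b1 b2 b3 b4
    simp only [not_false_eq_true, true_and]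
  · obtain ⟨a1, a2, a3, a4⟩ := series_open ends a u e Qu he hua hQu heQ z hz hsa hca
    obtain ⟨b1, b2, b3, b4⟩ := series_open ends a u e Qu he hua hQu heQ z hz hca hsa
    rw [r1]
    rw [a1, a2]


open Classical in
include he hua hsa hca hQu heQ in
/-- **Series piece, `2·Ga(piece) = #isoC(sub) + #good(sub)`** (sub-instance `(Qᵤ; s, u, c)`, counts over all configurations). [this work] -/
theorem two_mul_card_series_Ga :
    2 * (univ.filter fun z : α → Bool =>
        (((¬ (openGraph (labelledOpen ends fun y => z y && decide (y = e ∨ Qu y))).Reachable s a ∧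
        ¬ (openGraph (labelledOpen ends fun y => z y && decide (y = e ∨ Qu y))).Reachable s c) ∧
        (¬ (openGraph (labelledOpen ends fun y => z y && decide (y = e ∨ Qu y))).Reachable c a ∧
        ¬ (openGraph (labelledOpen ends fun y => z y && decide (y = e ∨ Qu y))).Reachable c s)) ∧
        (¬ (openGraph (labelledOpen ends fun l =>
          clusterFlip ends a (fun y => !(z y && decide (y = e ∨ Qu y))) l && decide (l = e ∨ Qu l))).Reachable c a ∧
        ¬ (openGraph (labelledOpen ends fun l =>
          clusterFlip ends a (fun y => !(z y && decide (y = e ∨ Qu y))) l && decide (l = e ∨ Qu l))).Reachable c s))).card =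
    (univ.filter fun z : α → Bool =>
        (¬ (openGraph (labelledOpen ends fun y => z y && decide (Qu y))).Reachable c u ∧
        ¬ (openGraph (labelledOpen ends fun y => z y && decide (Qu y))).Reachable c s)).card +
    (univ.filter fun z : α → Bool =>
        (((¬ (openGraph (labelledOpen ends fun y => z y && decide (Qu y))).Reachable s u ∧
        ¬ (openGraph (labelledOpen ends fun y => z y && decide (Qu y))).Reachable s c) ∧
        (¬ (openGraph (labelledOpen ends fun y => z y && decide (Qu y))).Reachable c u ∧
        ¬ (openGraph (labelledOpen ends fun y => z y && decide (Qu y))).Reachable c s)) ∧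
        ¬ (openGraph (labelledOpen ends fun l => clusterFlip ends u (fun y => !(z y && decide (Qu y))) l && decide (Qu l))).Reachable c s)).card := by
  have hW := restrictU_update_apply e Qu heQ
  have r0 : ∀ (P₀ P₁ : Prop), ((false = false ∧ P₀) ∨ (false = true ∧ P₁)) ↔ P₀ := fun P₀ P₁ => by simp
  have r1 : ∀ (P₀ P₁ : Prop), ((true = false ∧ P₀) ∨ (true = true ∧ P₁)) ↔ P₁ := fun P₀ P₁ => by simp
  refine two_mul_card_filter_split e _ _ _ (fun z b => by simp only [hW]) (fun z b => by simp only [hW]) fun z => ?_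
  cases hz : z e
  · obtain ⟨a1, a2, a3, a4⟩ := series_closed ends a u e Qu he hua hQu heQ z hz hsa hca
    obtain ⟨b1, b2, b3, b4⟩ := series_closed ends a u e Qu he hua hQu heQ z hz hca hsa
    rw [r0]
    rw [a1, a2, b1, b2, b3, b4]
    clear a3 a4
    constructor
    · intro h; exact h.2
    · intro h; exact ⟨⟨⟨not_false, fun h' => h.2 h'.symm⟩, ⟨not_false, h.2⟩⟩, h⟩
  · obtain ⟨a1, a2, a3, a4⟩ := series_open ends a u e Qu he hua hQu heQ z hz hsa hca
    obtain ⟨b1, b2, b3, b4⟩ := series_open ends a u e Qu he hua hQu heQ z hz hca hsa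
    rw [r1]
    rw [a1, a2, b1, b2, b3, b4]
    clear a3 a4
    constructor
    · intro h; exact ⟨h.1, h.2.2⟩
    · intro h; exact ⟨h.1, not_false, h.2⟩


open Classical in
include he hua hsa hca hQu heQ in
/-- **Series piece, `2·Gb(piece) = #isoS(sub) + #good(sub)`** (sub-instance `(Qᵤ; s, u, c)`, counts over all configurations). [this work] -/
theorem two_mul_card_series_Gb :
    2 * (univ.filter fun z : α → Bool =>
        (((¬ (openGraph (labelledOpen ends fun y => z y && decide (y = e ∨ Qu y))).Reachable s a ∧
        ¬ (openGraph (labelledOpen ends fun y => z y && decide (y = e ∨ Qu y))).Reachable s c) ∧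
        (¬ (openGraph (labelledOpen ends fun y => z y && decide (y = e ∨ Qu y))).Reachable c a ∧
        ¬ (openGraph (labelledOpen ends fun y => z y && decide (y = e ∨ Qu y))).Reachable c s)) ∧
        (¬ (openGraph (labelledOpen ends fun l =>
          clusterFlip ends a (fun y => !(z y && decide (y = e ∨ Qu y))) l && decide (l = e ∨ Qu l))).Reachable s a ∧
        ¬ (openGraph (labelledOpen ends fun l =>
          clusterFlip ends a (fun y => !(z y && decide (y = e ∨ Qu y))) l && decide (l = e ∨ Qu l))).Reachable s c))).card =
    (univ.filter fun z : α → Bool =>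
        (¬ (openGraph (labelledOpen ends fun y => z y && decide (Qu y))).Reachable s u ∧
        ¬ (openGraph (labelledOpen ends fun y => z y && decide (Qu y))).Reachable s c)).card +
    (univ.filter fun z : α → Bool =>
        (((¬ (openGraph (labelledOpen ends fun y => z y && decide (Qu y))).Reachable s u ∧
        ¬ (openGraph (labelledOpen ends fun y => z y && decide (Qu y))).Reachable s c) ∧
        (¬ (openGraph (labelledOpen ends fun y => z y && decide (Qu y))).Reachable c u ∧
        ¬ (openGraph (labelledOpen ends fun y => z y && decide (Qu y))).Reachable c s)) ∧
        ¬ (openGraph (labelledOpen ends fun l => clusterFlip ends u (fun y => !(z y && decide (Qu y))) l && decide (Qu l))).Reachable c s)).card := by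
  have hW := restrictU_update_apply e Qu heQ
  have r0 : ∀ (P₀ P₁ : Prop), ((false = false ∧ P₀) ∨ (false = true ∧ P₁)) ↔ P₀ := fun P₀ P₁ => by simp
  have r1 : ∀ (P₀ P₁ : Prop), ((true = false ∧ P₀) ∨ (true = true ∧ P₁)) ↔ P₁ := fun P₀ P₁ => by simp
  refine two_mul_card_filter_split e _ _ _ (fun z b => by simp only [hW]) (fun z b => by simp only [hW]) fun z => ?_
  cases hz : z e
  · obtain ⟨a1, a2, a3, a4⟩ := series_closed ends a u e Qu he hua hQu heQ z hz hsa hca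
    obtain ⟨b1, b2, b3, b4⟩ := series_closed ends a u e Qu he hua hQu heQ z hz hca hsa
    rw [r0]
    rw [a1, a2, b1, b2, a3, a4]
    clear b3 b4
    constructor
    · intro h; exact h.2
    · intro h; exact ⟨⟨⟨not_false, h.2⟩, ⟨not_false, fun h' => h.2 h'.symm⟩⟩, h⟩
  · obtain ⟨a1, a2, a3, a4⟩ := series_open ends a u e Qu he hua hQu heQ z hz hsa hca
    obtain ⟨b1, b2, b3, b4⟩ := series_open ends a u e Qu he hua hQu heQ z hz hca hsa
    rw [r1]
    rw [a1, a2, b1, b2, a3, a4]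
    clear b3 b4
    constructor
    · intro h; exact ⟨h.1, fun h' => h.2.2 h'.symm⟩
    · intro h; exact ⟨h.1, not_false, fun h' => h.2 h'.symm⟩


open Classical in
include he hua hsa hca hQu heQ in
/-- **Series piece, `2·G1(piece) = #S0(sub) + #good(sub)`** (sub-instance `(Qᵤ; s, u, c)`, counts over all configurations). [this work] -/
theorem two_mul_card_series_G1 :
    2 * (univ.filter fun z : α → Bool =>
        (((¬ (openGraph (labelledOpen ends fun y => z y && decide (y = e ∨ Qu y))).Reachable s a ∧
        ¬ (openGraph (labelledOpen ends fun y => z y && decide (y = e ∨ Qu y))).Reachable s c) ∧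
        (¬ (openGraph (labelledOpen ends fun y => z y && decide (y = e ∨ Qu y))).Reachable c a ∧
        ¬ (openGraph (labelledOpen ends fun y => z y && decide (y = e ∨ Qu y))).Reachable c s)) ∧
        ((¬ (openGraph (labelledOpen ends fun l =>
          clusterFlip ends a (fun y => !(z y && decide (y = e ∨ Qu y))) l && decide (l = e ∨ Qu l))).Reachable s a ∧
        ¬ (openGraph (labelledOpen ends fun l =>
          clusterFlip ends a (fun y => !(z y && decide (y = e ∨ Qu y))) l && decide (l = e ∨ Qu l))).Reachable s c) ∧
        (¬ (openGraph (labelledOpen ends fun l =>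
          clusterFlip ends a (fun y => !(z y && decide (y = e ∨ Qu y))) l && decide (l = e ∨ Qu l))).Reachable c a ∧
        ¬ (openGraph (labelledOpen ends fun l =>
          clusterFlip ends a (fun y => !(z y && decide (y = e ∨ Qu y))) l && decide (l = e ∨ Qu l))).Reachable c s)))).card =
    (univ.filter fun z : α → Bool =>
        ((¬ (openGraph (labelledOpen ends fun y => z y && decide (Qu y))).Reachable s u ∧
        ¬ (openGraph (labelledOpen ends fun y => z y && decide (Qu y))).Reachable s c) ∧
        (¬ (openGraph (labelledOpen ends fun y => z y && decide (Qu y))).Reachable c u ∧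
        ¬ (openGraph (labelledOpen ends fun y => z y && decide (Qu y))).Reachable c s))).card +
    (univ.filter fun z : α → Bool =>
        (((¬ (openGraph (labelledOpen ends fun y => z y && decide (Qu y))).Reachable s u ∧
        ¬ (openGraph (labelledOpen ends fun y => z y && decide (Qu y))).Reachable s c) ∧
        (¬ (openGraph (labelledOpen ends fun y => z y && decide (Qu y))).Reachable c u ∧
        ¬ (openGraph (labelledOpen ends fun y => z y && decide (Qu y))).Reachable c s)) ∧
        ¬ (openGraph (labelledOpen ends fun l => clusterFlip ends u (fun y => !(z y && decide (Qu y))) l && decide (Qu l))).Reachable c s)).card := by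
  have hW := restrictU_update_apply e Qu heQ
  have r0 : ∀ (P₀ P₁ : Prop), ((false = false ∧ P₀) ∨ (false = true ∧ P₁)) ↔ P₀ := fun P₀ P₁ => by simp
  have r1 : ∀ (P₀ P₁ : Prop), ((true = false ∧ P₀) ∨ (true = true ∧ P₁)) ↔ P₁ := fun P₀ P₁ => by simp
  refine two_mul_card_filter_split e _ _ _ (fun z b => by simp only [hW]) (fun z b => by simp only [hW]) fun z => ?_
  cases hz : z e
  · obtain ⟨a1, a2, a3, a4⟩ := series_closed ends a u e Qu he hua hQu heQ z hz hsa hca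
    obtain ⟨b1, b2, b3, b4⟩ := series_closed ends a u e Qu he hua hQu heQ z hz hca hsa
    rw [r0]
    rw [a1, a2, b1, b2, a3, a4, b3, b4]
    constructor
    · intro h; exact h.2
    · intro h; exact ⟨⟨⟨not_false, h.1.2⟩, ⟨not_false, h.2.2⟩⟩, h⟩
  · obtain ⟨a1, a2, a3, a4⟩ := series_open ends a u e Qu he hua hQu heQ z hz hsa hca
    obtain ⟨b1, b2, b3, b4⟩ := series_open ends a u e Qu he hua hQu heQ z hz hca hsa
    rw [r1]
    rw [a1, a2, b1, b2, a3, a4, b3, b4]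
    constructor
    · intro h; exact ⟨h.1, h.2.2.2⟩
    · intro h; exact ⟨h.1, ⟨not_false, fun h' => h.2 h'.symm⟩, ⟨not_false, h.2⟩⟩

open Classical in
omit [DecidableEq V] in
/-- The three spellings of `s ↮ c` in the sub-instance have the same count. [this work] -/
theorem card_series_nsc_forms :
    (univ.filter fun z : α → Bool =>
        (¬ (openGraph (labelledOpen ends fun y => z y && decide (Qu y))).Reachable s c ∧
        ¬ (openGraph (labelledOpen ends fun y => z y && decide (Qu y))).Reachable c s)).card =
      (univ.filter fun z : α → Bool => ¬ (openGraph (labelledOpen ends fun y => z y && decide (Qu y))).Reachable s c).card ∧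
    (univ.filter fun z : α → Bool => ¬ (openGraph (labelledOpen ends fun y => z y && decide (Qu y))).Reachable c s).card =
      (univ.filter fun z : α → Bool => ¬ (openGraph (labelledOpen ends fun y => z y && decide (Qu y))).Reachable s c).card := by
  refine ⟨congrArg Finset.card (Finset.filter_congr fun z _ => ?_), congrArg Finset.card (Finset.filter_congr fun z _ => ?_)⟩
  · constructor
    · intro h; exact h.1
    · intro h; exact ⟨h, fun h' => h h'.symm⟩
  · constructor
    · intro h h'; exact h h'.symm
    · intro h h'; exact h h'.symm

open Classical in
omit [DecidableEq V] in
/-- `#{s ↮ c} + #S0 = #isoS + #isoC` in the sub-instance: `{s ↮ c} = isoS ∪ isoC` (if `s ↮ c` then `u` misses `s` or `c`) and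
`isoS ∩ isoC = S0`. [this work] -/
theorem card_series_nsc_add_S0 :
    (univ.filter fun z : α → Bool => ¬ (openGraph (labelledOpen ends fun y => z y && decide (Qu y))).Reachable s c).card +
    (univ.filter fun z : α → Bool =>
        ((¬ (openGraph (labelledOpen ends fun y => z y && decide (Qu y))).Reachable s u ∧
        ¬ (openGraph (labelledOpen ends fun y => z y && decide (Qu y))).Reachable s c) ∧
        (¬ (openGraph (labelledOpen ends fun y => z y && decide (Qu y))).Reachable c u ∧
        ¬ (openGraph (labelledOpen ends fun y => z y && decide (Qu y))).Reachable c s))).card =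
    (univ.filter fun z : α → Bool =>
        (¬ (openGraph (labelledOpen ends fun y => z y && decide (Qu y))).Reachable s u ∧
        ¬ (openGraph (labelledOpen ends fun y => z y && decide (Qu y))).Reachable s c)).card +
    (univ.filter fun z : α → Bool =>
        (¬ (openGraph (labelledOpen ends fun y => z y && decide (Qu y))).Reachable c u ∧
        ¬ (openGraph (labelledOpen ends fun y => z y && decide (Qu y))).Reachable c s)).card := by
  have hU : (univ.filter fun z : α → Bool => ¬ (openGraph (labelledOpen ends fun y => z y && decide (Qu y))).Reachable s c) =
      (univ.filter fun z : α → Bool =>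
        (¬ (openGraph (labelledOpen ends fun y => z y && decide (Qu y))).Reachable s u ∧
        ¬ (openGraph (labelledOpen ends fun y => z y && decide (Qu y))).Reachable s c)) ∪
      (univ.filter fun z : α → Bool =>
        (¬ (openGraph (labelledOpen ends fun y => z y && decide (Qu y))).Reachable c u ∧
        ¬ (openGraph (labelledOpen ends fun y => z y && decide (Qu y))).Reachable c s)) := by
    rw [← Finset.filter_or]
    refine Finset.filter_congr fun z _ => ?_
    constructor
    · intro h
      by_cases hsu : (openGraph (labelledOpen ends fun y => z y && decide (Qu y))).Reachable s u
      · right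
        exact ⟨fun h' => h (hsu.trans h'.symm), fun h' => h h'.symm⟩
      · left
        exact ⟨hsu, h⟩
    · rintro (h | h)
      · exact h.2
      · exact fun h' => h.2 h'.symm
  have hI : (univ.filter fun z : α → Bool =>
        ((¬ (openGraph (labelledOpen ends fun y => z y && decide (Qu y))).Reachable s u ∧
        ¬ (openGraph (labelledOpen ends fun y => z y && decide (Qu y))).Reachable s c) ∧
        (¬ (openGraph (labelledOpen ends fun y => z y && decide (Qu y))).Reachable c u ∧
        ¬ (openGraph (labelledOpen ends fun y => z y && decide (Qu y))).Reachable c s))) =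
      (univ.filter fun z : α → Bool =>
        (¬ (openGraph (labelledOpen ends fun y => z y && decide (Qu y))).Reachable s u ∧
        ¬ (openGraph (labelledOpen ends fun y => z y && decide (Qu y))).Reachable s c)) ∩
      (univ.filter fun z : α → Bool =>
        (¬ (openGraph (labelledOpen ends fun y => z y && decide (Qu y))).Reachable c u ∧
        ¬ (openGraph (labelledOpen ends fun y => z y && decide (Qu y))).Reachable c s)) := by
    rw [← Finset.filter_and]
  rw [hU, hI]
  exact Finset.card_union_add_card_inter _ _

end SeriesCounts

end Summit.CriticalPhenomena.PercolationContinuityZ3.Theorems.ProductFormFibre
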